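import Summits.HubbardSuperconductivity.HubbardLadder.HubbardDopedAFWindowGlue
import Summits.HubbardSuperconductivity.HubbardLadder.Bounds.TorusTTPrimeRows4x4
import HarnessLib

/-!
# R2 device D31 — `t'`-GENERIC `S^z`-resolution edges for sector-mode observable certificates, and the TYPED
# SHAPES of the doped `t' = -1/4`, `t' = -1/5` rows (`4 × 4` torus, `U = 8`, `N = 14`) keyed to the in-tree
# exact-Rayleigh `t–t'` upper nodes BY NAME

HONEST FRAMING (page 1): ladder R1–R4 with certified numbers; no claim on H/H₀.

HONEST LABEL: PROVED IMPLICATIONS ONLY — no claim node, no number, nothing instantiated, nothing run. No `t' ≠ 0`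
sector-mode observable certificate exists (2026-08-20); the cell lead's sizing request LEAD LINE (T)
('engA-secrows1-N14-tprime', text-first, no GO) asks what such certificates would cost and which typed nodes they
would discharge. This file answers the Lean half in advance, so that — IF the lead rules GO and the engines produce
certsdp/1 §9 sector-mode files at `t' ∈ {-1/4, -1/5}` with the exact-Rayleigh uppers of
`Bounds/TorusTTPrimeRows4x4` as their `energy_upper` row — the R2 rows are one `def` node + one line each,
exactly as devices D27/D28 were at `t' = 0`.

§1. `hubbardTorusTT' L t t' U = hamiltonian (n.n. torus) t U + hamiltonian (diagonal torus) t' 0` preserves the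
`(N↑, N↓)` sectors (`preservesSectors_hubbardTorusTT'`).

§2. GENERIC EDGES (every `L`, `t`, `t'`, `U`, `N`): a family of sector-mode observable certificates
`TorusSectorObsCertTT' L t t' U N M u X q`, one for every `S^z`-value `M` (a certsdp/1 §9 file WITHOUT `S^z` ideal
rows is one for every `M`), for a sector-preserving objective `X`, together with the energy hypothesis
`groundEnergy (hubbardTorusTT' L t t' U) N ≤ u`, gives `q ≤ Re ⟨ψ, X ψ⟩` for EVERY normalised `N`-particle ground
state `ψ` — `S^z`-eigen or not (`re_expect_ge_of_sectorObsCertsTT'`, upper reading `re_expect_le_of_sectorObsCertsTT'`;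
the `t' = 0`, `4 × 4`, `U = 8`, `N = 14` instance is D27's `re_expect_ge_of_sectorObsCerts_four_N14_U8`). The
`S^z`-resolution is D27's `re_expect_ge_of_forall_szSector` (sector projections of a ground state are sector ground
states; the bound is homogeneous).

§3. TYPED SHAPES at `t' = -1/4` and `t' = -1/5` (`4 × 4`, `t = 1`, `U = 8`, `N = 14`): with the energy constant
`u` := the claim constant of the in-tree exact-Rayleigh upper node `Bounds.torusTTUpper_tup_4x4_U8_N14_tpm1o4`
(`u₄ = -6757592964053/2³⁹ = -12.29198999…`, REFEREE item 73 SIGNED) resp. `…_tpm1o5` (`u₅ = -6651213355009/2³⁹`),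
transported from the rectangular presentation `hubbardRectTorusTT' 4 4` to the certificates' square presentation
`hubbardTorusTT' 4` by `groundEnergy_hubbardTorusTT'_eq_rect`, a LOWER/UPPER certificate pair for `X` gives the
two-sided window `Re ⟨ψ, X ψ⟩ ∈ [q_lo, -q_up]` for every ground state (`re_expect_mem_Icc_of_sectorObsCerts_four_N14_U8_tpm1o4/5`),
and hence the AF shape `m_s² = ⟨𝓢⟩/256 ∈ [q_lo/256, -q_up/256]` (`𝓢 = stagStructureFour`), the double-occupancy
shape `d = ⟨𝐃⟩/16 ∈ [q_lo/16, -q_up/16]` (`𝐃 = Σ_x n_{x↑}n_{x↓}`) and the local-moment shape `m_loc = 7/8 - 2d`.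
PRE-REGISTERED NODE NAMES (to be declared, with the certificates' `claimed.E_cert` verbatim as `q`, by the seat that
types the files; house style of D27/D28): `secrowsAFlo_engA_4x4_U8_N14_tpm1o4 : Prop := ∀ M, Nonempty
(TorusSectorObsCertTT' 4 1 (-1/4) 8 14 M u₄ stagStructureFour q)`, `secrowsAFup_…_tpm1o4` (objective `-𝓢`),
`secrowsDlo/Dup_engA_4x4_U8_N14_tpm1o4` (objective `±𝐃`), and the same four with `tpm1o5` / `u₅`.

References: the certificate TYPE and its kernel edge — Wang et al. (2024) §3 (observable optimisation under an
energy row), Han (2020) §2; sector structure — Lieb, PRL 62 (1989) 1201, proof of Thm 1; Rayleigh uppers —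
Tasaki (2020) §2.1; the `t–t'` model — Xu et al., Science 384 (2024) eq. (1); `S(π,π)` convention — Hirsch,
PRB 31 (1985) 4403, eq. (4.7).
-/

namespace Summit.HubbardSuperconductivity.HubbardLadder

open Matrix Literature.MathematicalPhysics.QuantumLattice Literature.Probability.LatticeModels
open Finset hiding expect
open FermionSpinMoment Bounds
open scoped ComplexOrder

/-! ## §1 The `t–t'` torus Hamiltonian preserves the spin sectors -/

/-- `hubbardTorusTT' L t t' U` is block diagonal in the sectors `(N↑, N↓)` (both hopping terms and the
interaction conserve `N↑`, `N↓`). [cite: LiebPRL1989, proof of Theorem 1] -/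
theorem preservesSectors_hubbardTorusTT' (L : ℕ) (t t' U : ℝ) : PreservesSectors (hubbardTorusTT' L t t' U) :=
  (LiebThm1.preservesSectors_hamiltonian (fermionTorusGraph 2 L) t U).add
    (LiebThm1.preservesSectors_hamiltonian (fermionTorusDiagGraph L) t' 0)

/-! ## §2 Generic `S^z`-resolution edges for `TorusSectorObsCertTT' L t t' U N M u X q` -/

section Generic

variable {L : ℕ} [NeZero L] {t t' U : ℝ} {N : ℕ} {u : ℝ}

/-- **Generic LOWER edge (every `L`, `t`, `t'`, `U`, `N`).** Sector-mode observable certificates for a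
sector-preserving `X`, one for every `M`, with energy constant `u ≥ E_N(hubbardTorusTT' L t t' U)`, give
`q ≤ Re ⟨ψ, X ψ⟩` for EVERY normalised `N`-particle ground state `ψ`. HONEST FRAMING: ladder R1–R4 with
certified numbers; no claim on H/H₀. [cite: WangEtAl2024, §3 eq. (obsopt)] -/
theorem re_expect_ge_of_sectorObsCertsTT'
    (hE : groundEnergy (hubbardTorusTT' L t t' U) N ≤ u)
    {X : Matrix (Finset (Orb (FermionTorus 2 L))) (Finset (Orb (FermionTorus 2 L))) ℂ} (hX : PreservesSectors X)
    {q : ℝ} (hC : ∀ M : ℝ, Nonempty (TorusSectorObsCertTT' L t t' U N M u X q))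
    {ψ : Fock (Orb (FermionTorus 2 L))} (hψ : IsGroundState (hubbardTorusTT' L t t' U) N ψ)
    (hψ1 : star ψ ⬝ᵥ ψ = 1) : q ≤ (expect X ψ).re :=
  re_expect_ge_of_forall_szSector (preservesSectors_hubbardTorusTT' L t t' U) hX
    (fun M _ hφK hφ1 hHφ => (hC M).some.re_expect_ge_of_eigenvector hφK hφ1 hHφ hE) hψ.1 hψ1 hψ.2.2

/-- **Generic UPPER edge**: certificates for `-X` with value `q` give `Re ⟨ψ, X ψ⟩ ≤ -q` for every normalised
`N`-particle ground state. HONEST FRAMING: ladder R1–R4 with certified numbers; no claim on H/H₀.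
[cite: WangEtAl2024, §3 eq. (obsopt)] -/
theorem re_expect_le_of_sectorObsCertsTT'
    (hE : groundEnergy (hubbardTorusTT' L t t' U) N ≤ u)
    {X : Matrix (Finset (Orb (FermionTorus 2 L))) (Finset (Orb (FermionTorus 2 L))) ℂ} (hX : PreservesSectors X)
    {q : ℝ} (hC : ∀ M : ℝ, Nonempty (TorusSectorObsCertTT' L t t' U N M u (-X) q))
    {ψ : Fock (Orb (FermionTorus 2 L))} (hψ : IsGroundState (hubbardTorusTT' L t t' U) N ψ)
    (hψ1 : star ψ ⬝ᵥ ψ = 1) : (expect X ψ).re ≤ -q := by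
  have hX' : PreservesSectors (-X) := by simpa using hX.smul (-1)
  have h := re_expect_ge_of_sectorObsCertsTT' hE hX' hC hψ hψ1
  rw [expect, neg_mulVec, dotProduct_neg, Complex.neg_re] at h
  unfold expect
  linarith

/-- **Generic two-sided window**: a LOWER certificate family (objective `X`, value `q_lo`) and an UPPER one
(objective `-X`, value `q_up`) give `Re ⟨ψ, X ψ⟩ ∈ [q_lo, -q_up]` for every normalised `N`-particle ground state.
HONEST FRAMING: ladder R1–R4 with certified numbers; no claim on H/H₀. [cite: WangEtAl2024, §3 eq. (obsopt)] -/
theorem re_expect_mem_Icc_of_sectorObsCertsTT'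
    (hE : groundEnergy (hubbardTorusTT' L t t' U) N ≤ u)
    {X : Matrix (Finset (Orb (FermionTorus 2 L))) (Finset (Orb (FermionTorus 2 L))) ℂ} (hX : PreservesSectors X)
    {qlo qup : ℝ} (hlo : ∀ M : ℝ, Nonempty (TorusSectorObsCertTT' L t t' U N M u X qlo))
    (hup : ∀ M : ℝ, Nonempty (TorusSectorObsCertTT' L t t' U N M u (-X) qup))
    {ψ : Fock (Orb (FermionTorus 2 L))} (hψ : IsGroundState (hubbardTorusTT' L t t' U) N ψ)
    (hψ1 : star ψ ⬝ᵥ ψ = 1) : (expect X ψ).re ∈ Set.Icc qlo (-qup) :=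
  ⟨re_expect_ge_of_sectorObsCertsTT' hE hX hlo hψ hψ1, re_expect_le_of_sectorObsCertsTT' hE hX hup hψ hψ1⟩

end Generic

/-! ## §3 Typed shapes at `t' = -1/4` and `t' = -1/5` (`4 × 4`, `t = 1`, `U = 8`, `N = 14`) -/

section FourByFour

/-- The energy hypothesis at `t' = -1/4` in the certificates' presentation: the in-tree exact-Rayleigh node
`torusTTUpper_tup_4x4_U8_N14_tpm1o4` (rectangular presentation) transported by
`groundEnergy_hubbardTorusTT'_eq_rect`. HONEST FRAMING: ladder R1–R4 with certified numbers; no claim on H/H₀.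
[cite: Tasaki2020, §2.1] -/
theorem groundEnergy_hubbardTorusTT'_four_N14_U8_tpm1o4_le_of_claim (h : torusTTUpper_tup_4x4_U8_N14_tpm1o4) :
    groundEnergy (hubbardTorusTT' 4 1 (-1/4) 8) 14 ≤ (-6757592964053 : ℝ) / 2 ^ 39 := by
  rw [groundEnergy_hubbardTorusTT'_eq_rect]
  exact groundEnergy_tt_4x4_U8_N14_tpm1o4_le_of_claim h

/-- The energy hypothesis at `t' = -1/5`, transported likewise from `torusTTUpper_tup_4x4_U8_N14_tpm1o5`.
HONEST FRAMING: ladder R1–R4 with certified numbers; no claim on H/H₀. [cite: Tasaki2020, §2.1] -/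
theorem groundEnergy_hubbardTorusTT'_four_N14_U8_tpm1o5_le_of_claim (h : torusTTUpper_tup_4x4_U8_N14_tpm1o5) :
    groundEnergy (hubbardTorusTT' 4 1 (-1/5) 8) 14 ≤ (-6651213355009 : ℝ) / 2 ^ 39 := by
  rw [groundEnergy_hubbardTorusTT'_eq_rect]
  exact groundEnergy_tt_4x4_U8_N14_tpm1o5_le_of_claim h

/-- **Typed window shape, `t' = -1/4`**: a LOWER/UPPER pair of sector-mode certificate families for a
sector-preserving `X`, written with the energy constant `u₄ = -6757592964053/2³⁹` of the node
`torusTTUpper_tup_4x4_U8_N14_tpm1o4` VERBATIM, gives `Re ⟨ψ, X ψ⟩ ∈ [q_lo, -q_up]` for every normalised `14`-particle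
ground state of `hubbardTorusTT' 4 1 (-1/4) 8` (no number: no such certificate exists yet). HONEST FRAMING: ladder
R1–R4 with certified numbers; no claim on H/H₀. [cite: WangEtAl2024, §3 eq. (obsopt)] -/
theorem re_expect_mem_Icc_of_sectorObsCerts_four_N14_U8_tpm1o4
    {X : Matrix (Finset (Orb (FermionTorus 2 4))) (Finset (Orb (FermionTorus 2 4))) ℂ} (hX : PreservesSectors X)
    {qlo qup : ℝ}
    (hlo : ∀ M : ℝ, Nonempty (TorusSectorObsCertTT' 4 1 (-1/4) 8 14 M ((-6757592964053 : ℝ) / 2 ^ 39) X qlo))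
    (hup : ∀ M : ℝ, Nonempty (TorusSectorObsCertTT' 4 1 (-1/4) 8 14 M ((-6757592964053 : ℝ) / 2 ^ 39) (-X) qup))
    (h : torusTTUpper_tup_4x4_U8_N14_tpm1o4) {ψ : Fock (Orb (FermionTorus 2 4))}
    (hψ : IsGroundState (hubbardTorusTT' 4 1 (-1/4) 8) 14 ψ) (hψ1 : star ψ ⬝ᵥ ψ = 1) :
    (expect X ψ).re ∈ Set.Icc qlo (-qup) :=
  re_expect_mem_Icc_of_sectorObsCertsTT' (groundEnergy_hubbardTorusTT'_four_N14_U8_tpm1o4_le_of_claim h)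
    hX hlo hup hψ hψ1

/-- **Typed window shape, `t' = -1/5`** (energy constant `u₅ = -6651213355009/2³⁹` of
`torusTTUpper_tup_4x4_U8_N14_tpm1o5` verbatim). HONEST FRAMING: ladder R1–R4 with certified numbers; no claim on
H/H₀. [cite: WangEtAl2024, §3 eq. (obsopt)] -/
theorem re_expect_mem_Icc_of_sectorObsCerts_four_N14_U8_tpm1o5
    {X : Matrix (Finset (Orb (FermionTorus 2 4))) (Finset (Orb (FermionTorus 2 4))) ℂ} (hX : PreservesSectors X)
    {qlo qup : ℝ}
    (hlo : ∀ M : ℝ, Nonempty (TorusSectorObsCertTT' 4 1 (-1/5) 8 14 M ((-6651213355009 : ℝ) / 2 ^ 39) X qlo))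
    (hup : ∀ M : ℝ, Nonempty (TorusSectorObsCertTT' 4 1 (-1/5) 8 14 M ((-6651213355009 : ℝ) / 2 ^ 39) (-X) qup))
    (h : torusTTUpper_tup_4x4_U8_N14_tpm1o5) {ψ : Fock (Orb (FermionTorus 2 4))}
    (hψ : IsGroundState (hubbardTorusTT' 4 1 (-1/5) 8) 14 ψ) (hψ1 : star ψ ⬝ᵥ ψ = 1) :
    (expect X ψ).re ∈ Set.Icc qlo (-qup) :=
  re_expect_mem_Icc_of_sectorObsCertsTT' (groundEnergy_hubbardTorusTT'_four_N14_U8_tpm1o5_le_of_claim h)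
    hX hlo hup hψ hψ1

/-- **AF shape, `t' = -1/4`** (pre-registered nodes `secrowsAF{lo,up}_engA_4x4_U8_N14_tpm1o4` would be `hlo`/`hup`
with `X = 𝓢 = stagStructureFour`): the squared staggered magnetisation `m_s² = ⟨𝓢⟩/256 ∈ [q_lo/256, -q_up/256]`
for every ground state. HONEST FRAMING: ladder R1–R4 with certified numbers; no claim on H/H₀.
[cite: HirschPRB1985, eq. (4.7)] [cite: WangEtAl2024, §3 eq. (obsopt)] -/
theorem stagMagSq_four_N14_U8_tpm1o4_mem_Icc_of_sectorObsCerts {qlo qup : ℝ}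
    (hlo : ∀ M : ℝ, Nonempty (TorusSectorObsCertTT' 4 1 (-1/4) 8 14 M ((-6757592964053 : ℝ) / 2 ^ 39)
      stagStructureFour qlo))
    (hup : ∀ M : ℝ, Nonempty (TorusSectorObsCertTT' 4 1 (-1/4) 8 14 M ((-6757592964053 : ℝ) / 2 ^ 39)
      (-stagStructureFour) qup))
    (h : torusTTUpper_tup_4x4_U8_N14_tpm1o4) {ψ : Fock (Orb (FermionTorus 2 4))}
    (hψ : IsGroundState (hubbardTorusTT' 4 1 (-1/4) 8) 14 ψ) (hψ1 : star ψ ⬝ᵥ ψ = 1) :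
    (expect stagStructureFour ψ).re / 256 ∈ Set.Icc (qlo / 256) (-qup / 256) := by
  obtain ⟨h1, h2⟩ := re_expect_mem_Icc_of_sectorObsCerts_four_N14_U8_tpm1o4 preservesSectors_stagStructureFour
    hlo hup h hψ hψ1
  constructor
  · exact div_le_div_of_nonneg_right h1 (by norm_num)
  · exact div_le_div_of_nonneg_right h2 (by norm_num)

/-- **AF shape, `t' = -1/5`.** HONEST FRAMING: ladder R1–R4 with certified numbers; no claim on H/H₀.
[cite: HirschPRB1985, eq. (4.7)] [cite: WangEtAl2024, §3 eq. (obsopt)] -/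
theorem stagMagSq_four_N14_U8_tpm1o5_mem_Icc_of_sectorObsCerts {qlo qup : ℝ}
    (hlo : ∀ M : ℝ, Nonempty (TorusSectorObsCertTT' 4 1 (-1/5) 8 14 M ((-6651213355009 : ℝ) / 2 ^ 39)
      stagStructureFour qlo))
    (hup : ∀ M : ℝ, Nonempty (TorusSectorObsCertTT' 4 1 (-1/5) 8 14 M ((-6651213355009 : ℝ) / 2 ^ 39)
      (-stagStructureFour) qup))
    (h : torusTTUpper_tup_4x4_U8_N14_tpm1o5) {ψ : Fock (Orb (FermionTorus 2 4))}
    (hψ : IsGroundState (hubbardTorusTT' 4 1 (-1/5) 8) 14 ψ) (hψ1 : star ψ ⬝ᵥ ψ = 1) :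
    (expect stagStructureFour ψ).re / 256 ∈ Set.Icc (qlo / 256) (-qup / 256) := by
  obtain ⟨h1, h2⟩ := re_expect_mem_Icc_of_sectorObsCerts_four_N14_U8_tpm1o5 preservesSectors_stagStructureFour
    hlo hup h hψ hψ1
  constructor
  · exact div_le_div_of_nonneg_right h1 (by norm_num)
  · exact div_le_div_of_nonneg_right h2 (by norm_num)

/-- **Double-occupancy and local-moment shape, `t' = -1/4`** (pre-registered nodes
`secrowsD{lo,up}_engA_4x4_U8_N14_tpm1o4` would be `hlo`/`hup` with `X = 𝐃 = Σ_x n_{x↑}n_{x↓}`): `d = ⟨𝐃⟩/16 ∈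
[q_lo/16, -q_up/16]` and `m_loc = ⟨Σ_x (n_{x↑}-n_{x↓})²⟩/16 = 7/8 - 2d ∈ [7/8 + q_up/8, 7/8 - q_lo/8]` for every
ground state. HONEST FRAMING: ladder R1–R4 with certified numbers; no claim on H/H₀.
[cite: HirschPRB1985, Table II] [cite: WangEtAl2024, §3 eq. (obsopt)] -/
theorem doubleOcc_localMoment_four_N14_U8_tpm1o4_of_sectorObsCerts {qlo qup : ℝ}
    (hlo : ∀ M : ℝ, Nonempty (TorusSectorObsCertTT' 4 1 (-1/4) 8 14 M ((-6757592964053 : ℝ) / 2 ^ 39)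
      (∑ x : FermionTorus 2 4, numberOp x 0 * numberOp x 1) qlo))
    (hup : ∀ M : ℝ, Nonempty (TorusSectorObsCertTT' 4 1 (-1/4) 8 14 M ((-6757592964053 : ℝ) / 2 ^ 39)
      (-(∑ x : FermionTorus 2 4, numberOp x 0 * numberOp x 1)) qup))
    (h : torusTTUpper_tup_4x4_U8_N14_tpm1o4) {ψ : Fock (Orb (FermionTorus 2 4))}
    (hψ : IsGroundState (hubbardTorusTT' 4 1 (-1/4) 8) 14 ψ) (hψ1 : star ψ ⬝ᵥ ψ = 1) :
    (expect (∑ x : FermionTorus 2 4, numberOp x 0 * numberOp x 1) ψ).re / 16 ∈ Set.Icc (qlo / 16) (-qup / 16) ∧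
      (expect localMomentFour ψ).re / 16 ∈ Set.Icc (7 / 8 + qup / 8) (7 / 8 - qlo / 8) := by
  obtain ⟨h1, h2⟩ := re_expect_mem_Icc_of_sectorObsCerts_four_N14_U8_tpm1o4 preservesSectors_doubleOcc
    hlo hup h hψ hψ1
  have hM := re_expect_localMomentFour hψ.1 hψ1
  refine ⟨⟨div_le_div_of_nonneg_right h1 (by norm_num), div_le_div_of_nonneg_right h2 (by norm_num)⟩, ?_, ?_⟩
  · rw [hM]; push_cast; linarith
  · rw [hM]; push_cast; linarith

/-- **Double-occupancy and local-moment shape, `t' = -1/5`.** HONEST FRAMING: ladder R1–R4 with certified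
numbers; no claim on H/H₀. [cite: HirschPRB1985, Table II] [cite: WangEtAl2024, §3 eq. (obsopt)] -/
theorem doubleOcc_localMoment_four_N14_U8_tpm1o5_of_sectorObsCerts {qlo qup : ℝ}
    (hlo : ∀ M : ℝ, Nonempty (TorusSectorObsCertTT' 4 1 (-1/5) 8 14 M ((-6651213355009 : ℝ) / 2 ^ 39)
      (∑ x : FermionTorus 2 4, numberOp x 0 * numberOp x 1) qlo))
    (hup : ∀ M : ℝ, Nonempty (TorusSectorObsCertTT' 4 1 (-1/5) 8 14 M ((-6651213355009 : ℝ) / 2 ^ 39)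
      (-(∑ x : FermionTorus 2 4, numberOp x 0 * numberOp x 1)) qup))
    (h : torusTTUpper_tup_4x4_U8_N14_tpm1o5) {ψ : Fock (Orb (FermionTorus 2 4))}
    (hψ : IsGroundState (hubbardTorusTT' 4 1 (-1/5) 8) 14 ψ) (hψ1 : star ψ ⬝ᵥ ψ = 1) :
    (expect (∑ x : FermionTorus 2 4, numberOp x 0 * numberOp x 1) ψ).re / 16 ∈ Set.Icc (qlo / 16) (-qup / 16) ∧
      (expect localMomentFour ψ).re / 16 ∈ Set.Icc (7 / 8 + qup / 8) (7 / 8 - qlo / 8) := by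
  obtain ⟨h1, h2⟩ := re_expect_mem_Icc_of_sectorObsCerts_four_N14_U8_tpm1o5 preservesSectors_doubleOcc
    hlo hup h hψ hψ1
  have hM := re_expect_localMomentFour hψ.1 hψ1
  refine ⟨⟨div_le_div_of_nonneg_right h1 (by norm_num), div_le_div_of_nonneg_right h2 (by norm_num)⟩, ?_, ?_⟩
  · rw [hM]; push_cast; linarith
  · rw [hM]; push_cast; linarith

/-- **Consistency with D27 at `t' = 0`**: the generic edge specialises to the `t' = 0` presentation
`hamiltonian (fermionTorusGraph 2 4) 1 8 = hubbardTorusTT' 4 1 0 8` (so D27/D28's rows are instances of §2).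
HONEST FRAMING: ladder R1–R4 with certified numbers; no claim on H/H₀. [cite: WangEtAl2024, §3 eq. (obsopt)] -/
theorem re_expect_ge_of_sectorObsCertsTT'_zero {u : ℝ}
    (hE : groundEnergy (hamiltonian (fermionTorusGraph 2 4) 1 8) 14 ≤ u)
    {X : Matrix (Finset (Orb (FermionTorus 2 4))) (Finset (Orb (FermionTorus 2 4))) ℂ} (hX : PreservesSectors X)
    {q : ℝ} (hC : ∀ M : ℝ, Nonempty (TorusSectorObsCertTT' 4 1 0 8 14 M u X q))
    {ψ : Fock (Orb (FermionTorus 2 4))} (hψ : IsGroundState (hamiltonian (fermionTorusGraph 2 4) 1 8) 14 ψ)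
    (hψ1 : star ψ ⬝ᵥ ψ = 1) : q ≤ (expect X ψ).re := by
  have hH : hubbardTorusTT' 4 1 0 8 = hamiltonian (fermionTorusGraph 2 4) 1 8 := by
    rw [hubbardTorusTT'_zero]; rfl
  rw [← hH] at hE hψ
  exact re_expect_ge_of_sectorObsCertsTT' hE hX hC hψ hψ1

end FourByFour

end Summit.HubbardSuperconductivity.HubbardLadder
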